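import Summits.QuantumFields.QCD.Theorems.HeatSlicedQuarksQuarkLoopCoefficientFreeMajorantToolkitAux

/-!
# Quark-loop coefficient, stub `freeMajorantToolkit`, part D: the complexified free symbol

Pointwise estimates for the free Gaussian bound (conjunct (1) of the free majorant toolkit of
the line `Sketch` of the crux `QuarkLoopCoefficient`).  The free Wilson symbol
`h(p) = Σ_μ sin² p_μ + (Σ_μ (1 − cos p_μ))²` (`hsymb`) extends to the entire function
`H(ζ) = Σ_μ sin² ζ_μ + (Σ_μ (1 − cos ζ_μ))²` of `ζ ∈ ℂ⁴`; shifting the Brillouin-zone contour to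
`ζ = p + iη` with `|η|_∞ ≤ 1` costs at most

  `Re H(p + iη) ≥ h(p)/2 − 14 |η|²`

(from `sin(p+iη) = sin p cosh η + i cos p sinh η`, `1 − cos(p+iη) = (1 − cos p cosh η) + i sin p sinh η`,
`cosh − 1 ≤ sinh²/2`, `sinh² η ≤ 2η²` on `|η| ≤ 1`, Cauchy–Schwarz), and gains the factor `e^{−η·w}`
from the character.  We also record the zone lower bound `h(p) ≥ (4/π²)|p|²` on `[−π, π]⁴`
(`h ≥ Σ 2(1 − cos p_μ) = Σ 4 sin²(p_μ/2)` and Jordan's inequality) and the resulting pointwise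
bound of the shifted integrand by a product of one-dimensional Gaussians.

Mathlib only.
-/

namespace Summit.QuantumFields.QCD.Cruxes.QuarkLoopCoefficient.Sketch.FreeMajorantToolkit

open Summit.QuantumFields.QCD.Theorems.QuarkLoopCoefficient
open Literature.MathematicalPhysics.QuantumLattice Literature.MathematicalPhysics.QuantumFieldTheory
open Literature.Probability.LatticeModels (Site TorusSite)
open scoped Matrix ComplexConjugate

/-! ### Hyperbolic bounds on `|η| ≤ 1` -/

/-- `sinh² b ≤ 2 b²` for `|b| ≤ 1`. -/
theorem sinh_sq_le {b : ℝ} (hb : |b| ≤ 1) : Real.sinh b ^ 2 ≤ 2 * b ^ 2 := by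
  have h1 : Real.sinh b ^ 2 = Real.cosh b ^ 2 - 1 := by
    have := Real.cosh_sq b
    linarith
  have h2 : Real.cosh b ^ 2 ≤ Real.exp (b ^ 2) := by
    have h := Real.cosh_le_exp_half_sq b
    calc Real.cosh b ^ 2 ≤ (Real.exp (b ^ 2 / 2)) ^ 2 :=
          pow_le_pow_left₀ (Real.cosh_pos _).le h 2
      _ = Real.exp (b ^ 2) := by rw [← Real.exp_nat_mul]; ring_nf
  have hb2 : b ^ 2 ≤ 1 := by
    have h := abs_nonneg b
    nlinarith [sq_abs b]
  have h3 : Real.exp (b ^ 2) - 1 ≤ 2 * b ^ 2 := by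
    have hb2' : |b ^ 2| ≤ 1 := by rwa [abs_of_nonneg (sq_nonneg _)]
    have h := Real.abs_exp_sub_one_sub_id_le hb2'
    have h4 : (b ^ 2) ^ 2 ≤ b ^ 2 := by nlinarith [sq_nonneg b]
    linarith [(abs_le.1 h).2]
  linarith

/-- `|cos a (cosh b − 1)| ≤ sinh² b / 2`. -/
theorem abs_cos_mul_cosh_sub_one_le (a b : ℝ) :
    |Real.cos a * (Real.cosh b - 1)| ≤ Real.sinh b ^ 2 / 2 := by
  have hC : 0 ≤ Real.cosh b - 1 := by linarith [Real.one_le_cosh b]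
  have hC2 : Real.cosh b - 1 ≤ Real.sinh b ^ 2 / 2 := by
    nlinarith [Real.cosh_sq b, sq_nonneg (Real.cosh b - 1)]
  rw [abs_mul, abs_of_nonneg hC]
  calc |Real.cos a| * (Real.cosh b - 1) ≤ 1 * (Real.cosh b - 1) := by
        gcongr; exact Real.abs_cos_le_one a
    _ ≤ Real.sinh b ^ 2 / 2 := by linarith

/-! ### The complexified symbol at `ζ = p + iη` -/

/-- `sin(a + ib) = sin a cosh b + i cos a sinh b`. -/
theorem csin_ofReal_add_mul_I (a b : ℝ) :
    Complex.sin ((a : ℂ) + (b : ℂ) * Complex.I) =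
      ((Real.sin a * Real.cosh b : ℝ) : ℂ) + ((Real.cos a * Real.sinh b : ℝ) : ℂ) * Complex.I := by
  rw [Complex.sin_add, Complex.sin_mul_I, Complex.cos_mul_I, ← Complex.ofReal_sin,
    ← Complex.ofReal_cos, ← Complex.ofReal_sinh, ← Complex.ofReal_cosh]
  push_cast
  ring

/-- `1 − cos(a + ib) = (1 − cos a cosh b) + i sin a sinh b`. -/
theorem one_sub_ccos_ofReal_add_mul_I (a b : ℝ) :
    1 - Complex.cos ((a : ℂ) + (b : ℂ) * Complex.I) =
      ((1 - Real.cos a * Real.cosh b : ℝ) : ℂ) + ((Real.sin a * Real.sinh b : ℝ) : ℂ) * Complex.I := by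
  rw [Complex.cos_add, Complex.sin_mul_I, Complex.cos_mul_I, ← Complex.ofReal_sin,
    ← Complex.ofReal_cos, ← Complex.ofReal_sinh, ← Complex.ofReal_cosh]
  push_cast
  ring

/-- `Re (X + iY)² = X² − Y²`. -/
theorem re_sq_ofReal_add_mul_I (X Y : ℝ) :
    (((X : ℂ) + (Y : ℂ) * Complex.I) ^ 2).re = X ^ 2 - Y ^ 2 := by
  simp [sq, Complex.mul_re, Complex.mul_im]

/-- The KEY POINTWISE ESTIMATE of the contour shift: for `|η_μ| ≤ 1`,
`Re H(p + iη) ≥ h(p)/2 − 14 Σ_μ η_μ²`. -/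
theorem re_symbol_shift_ge (p η : Fin 4 → ℝ) (ξ : Fin 4 → ℂ)
    (hξ : ∀ μ, ξ μ = (p μ : ℂ) + (η μ : ℂ) * Complex.I) (hη : ∀ μ, |η μ| ≤ 1) :
    hsymb p / 2 - 14 * ∑ μ, η μ ^ 2 ≤
      ((∑ μ, Complex.sin (ξ μ) ^ 2) + (∑ μ, (1 - Complex.cos (ξ μ))) ^ 2).re := by
  have hsin : ∀ μ, Complex.sin (ξ μ) = ((Real.sin (p μ) * Real.cosh (η μ) : ℝ) : ℂ) +
      ((Real.cos (p μ) * Real.sinh (η μ) : ℝ) : ℂ) * Complex.I := fun μ => by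
    rw [hξ]; exact csin_ofReal_add_mul_I (p μ) (η μ)
  have hcos : ∀ μ, 1 - Complex.cos (ξ μ) = ((1 - Real.cos (p μ) * Real.cosh (η μ) : ℝ) : ℂ) +
      ((Real.sin (p μ) * Real.sinh (η μ) : ℝ) : ℂ) * Complex.I := fun μ => by
    rw [hξ]; exact one_sub_ccos_ofReal_add_mul_I (p μ) (η μ)
  have hre : ((∑ μ, Complex.sin (ξ μ) ^ 2) + (∑ μ, (1 - Complex.cos (ξ μ))) ^ 2).re =
      ∑ μ, ((Real.sin (p μ) * Real.cosh (η μ)) ^ 2 - (Real.cos (p μ) * Real.sinh (η μ)) ^ 2) +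
        ((∑ μ, (1 - Real.cos (p μ) * Real.cosh (η μ))) ^ 2 -
          (∑ μ, Real.sin (p μ) * Real.sinh (η μ)) ^ 2) := by
    simp_rw [hsin, hcos]
    rw [Complex.add_re, Complex.re_sum]
    congr 1
    · exact Finset.sum_congr rfl fun μ _ => re_sq_ofReal_add_mul_I _ _
    · have e : ∑ μ : Fin 4, (((1 - Real.cos (p μ) * Real.cosh (η μ) : ℝ) : ℂ) +
          ((Real.sin (p μ) * Real.sinh (η μ) : ℝ) : ℂ) * Complex.I) =
          ((∑ μ : Fin 4, (1 - Real.cos (p μ) * Real.cosh (η μ)) : ℝ) : ℂ) +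
            ((∑ μ : Fin 4, Real.sin (p μ) * Real.sinh (η μ) : ℝ) : ℂ) * Complex.I := by
        push_cast
        rw [Finset.sum_add_distrib, Finset.sum_mul]
      rw [e]
      exact re_sq_ofReal_add_mul_I _ _
  rw [hre]
  -- pure real estimates
  have hS2 : ∀ μ, Real.sinh (η μ) ^ 2 ≤ 2 * η μ ^ 2 := fun μ => sinh_sq_le (hη μ)
  have hη2 : ∀ μ, η μ ^ 2 ≤ 1 := fun μ => by
    have h := abs_nonneg (η μ)
    have h' := hη μ
    nlinarith [sq_abs (η μ)]
  have hS2' : ∀ μ, Real.sinh (η μ) ^ 2 ≤ 2 := fun μ => (hS2 μ).trans (by linarith [hη2 μ])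
  have h1 : ∀ μ, Real.sin (p μ) ^ 2 - Real.sinh (η μ) ^ 2 ≤
      (Real.sin (p μ) * Real.cosh (η μ)) ^ 2 - (Real.cos (p μ) * Real.sinh (η μ)) ^ 2 := by
    intro μ
    have hC := Real.cosh_sq (η μ)
    have hc := Real.sin_sq_add_cos_sq (p μ)
    nlinarith [mul_nonneg (sq_nonneg (Real.sin (p μ))) (sq_nonneg (Real.sinh (η μ)))]
  have h1s := Finset.sum_le_sum fun μ (_ : μ ∈ Finset.univ) => h1 μ
  rw [Finset.sum_sub_distrib] at h1s
  have hW : ∑ μ, (1 - Real.cos (p μ) * Real.cosh (η μ)) =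
      (∑ μ, (1 - Real.cos (p μ))) - ∑ μ, Real.cos (p μ) * (Real.cosh (η μ) - 1) := by
    rw [← Finset.sum_sub_distrib]
    exact Finset.sum_congr rfl fun μ _ => by ring
  have hW₁ : |∑ μ, Real.cos (p μ) * (Real.cosh (η μ) - 1)| ≤ (∑ μ, Real.sinh (η μ) ^ 2) / 2 :=
    (Finset.abs_sum_le_sum_abs _ _).trans (by
      rw [Finset.sum_div]
      exact Finset.sum_le_sum fun μ _ => abs_cos_mul_cosh_sub_one_le _ _)
  have hSS0 : 0 ≤ ∑ μ, Real.sinh (η μ) ^ 2 := Finset.sum_nonneg fun μ _ => sq_nonneg _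
  have hSS : ∑ μ, Real.sinh (η μ) ^ 2 ≤ 8 := by
    have h := Finset.sum_le_sum fun μ (_ : μ ∈ Finset.univ) => hS2' μ
    have h8 : ∑ _μ : Fin 4, (2 : ℝ) = 8 := by norm_num [Finset.sum_const]
    linarith
  have hW₁sq : (∑ μ, Real.cos (p μ) * (Real.cosh (η μ) - 1)) ^ 2 ≤
      2 * ∑ μ, Real.sinh (η μ) ^ 2 := by
    have h := pow_le_pow_left₀ (abs_nonneg _) hW₁ 2
    rw [sq_abs] at h
    nlinarith
  have hV : (∑ μ, Real.sin (p μ) * Real.sinh (η μ)) ^ 2 ≤ 4 * ∑ μ, Real.sinh (η μ) ^ 2 := by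
    have hcs := Finset.sum_mul_sq_le_sq_mul_sq Finset.univ (fun μ => Real.sin (p μ))
      (fun μ => Real.sinh (η μ))
    have hs4 : ∑ μ : Fin 4, Real.sin (p μ) ^ 2 ≤ 4 := by
      have h := Finset.sum_le_sum fun μ (_ : μ ∈ Finset.univ) => Real.sin_sq_le_one (p μ)
      have h4 : ∑ _μ : Fin 4, (1 : ℝ) = 4 := by norm_num [Finset.sum_const]
      linarith
    calc _ ≤ (∑ μ, Real.sin (p μ) ^ 2) * ∑ μ, Real.sinh (η μ) ^ 2 := hcs
      _ ≤ 4 * ∑ μ, Real.sinh (η μ) ^ 2 := by gcongr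
  have hW2 : (∑ μ, (1 - Real.cos (p μ))) ^ 2 / 2 -
      (∑ μ, Real.cos (p μ) * (Real.cosh (η μ) - 1)) ^ 2 ≤
      ((∑ μ, (1 - Real.cos (p μ))) - ∑ μ, Real.cos (p μ) * (Real.cosh (η μ) - 1)) ^ 2 := by
    nlinarith [sq_nonneg ((∑ μ, (1 - Real.cos (p μ))) -
      2 * ∑ μ, Real.cos (p μ) * (Real.cosh (η μ) - 1))]
  have hSη : ∑ μ, Real.sinh (η μ) ^ 2 ≤ 2 * ∑ μ, η μ ^ 2 := by
    rw [Finset.mul_sum]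
    exact Finset.sum_le_sum fun μ _ => hS2 μ
  have hs0 : 0 ≤ ∑ μ : Fin 4, Real.sin (p μ) ^ 2 := Finset.sum_nonneg fun μ _ => sq_nonneg _
  have hh : hsymb p = ∑ μ, Real.sin (p μ) ^ 2 + (∑ μ, (1 - Real.cos (p μ))) ^ 2 := rfl
  rw [hW, hh]
  linarith

/-- The modulus of the shifted integrand: for `ξ = p + iη`, `t ≥ 0`, `|η_μ| ≤ 1` and `w ∈ ℤ⁴`,
`‖exp(−t H(ξ) + i ξ·w)‖ ≤ exp(−t h(p)/2 + 14 t |η|²) · exp(−η·w)`. -/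
theorem norm_shifted_integrand_le {t : ℝ} (ht : 0 ≤ t) (w : Site 4) (p η : Fin 4 → ℝ)
    (ξ : Fin 4 → ℂ) (hξ : ∀ μ, ξ μ = (p μ : ℂ) + (η μ : ℂ) * Complex.I) (hη : ∀ μ, |η μ| ≤ 1) :
    ‖Complex.exp (-(t : ℂ) * ((∑ μ, Complex.sin (ξ μ) ^ 2) + (∑ μ, (1 - Complex.cos (ξ μ))) ^ 2) +
        Complex.I * ∑ μ, ξ μ * ((w μ : ℤ) : ℂ))‖ ≤
      Real.exp (-(t * (hsymb p / 2)) + 14 * t * ∑ μ, η μ ^ 2) *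
        Real.exp (-(∑ μ, η μ * ((w μ : ℤ) : ℝ))) := by
  rw [Complex.norm_exp, ← Real.exp_add, Complex.add_re]
  apply Real.exp_le_exp.2
  have h1 := re_symbol_shift_ge p η ξ hξ hη
  have h2 : (Complex.I * ∑ μ, ξ μ * ((w μ : ℤ) : ℂ)).re = -(∑ μ, η μ * ((w μ : ℤ) : ℝ)) := by
    rw [Complex.I_mul_re, Complex.im_sum, ← Finset.sum_neg_distrib, ← Finset.sum_neg_distrib]
    refine Finset.sum_congr rfl fun μ _ => ?_
    rw [hξ]
    simp [Complex.mul_im]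
  have h3 : (-(t : ℂ) * ((∑ μ, Complex.sin (ξ μ) ^ 2) + (∑ μ, (1 - Complex.cos (ξ μ))) ^ 2)).re =
      -(t * ((∑ μ, Complex.sin (ξ μ) ^ 2) + (∑ μ, (1 - Complex.cos (ξ μ))) ^ 2).re) := by
    rw [Complex.mul_re]
    simp
  rw [h2, h3]
  nlinarith [mul_le_mul_of_nonneg_left h1 ht]

/-! ### The zone lower bound and the Gaussian product majorant -/

/-- `2(1 − cos a) ≥ (4/π²) a²` for `|a| ≤ π` (Jordan's inequality at `a/2`). -/
theorem sq_le_one_sub_cos {a : ℝ} (ha : |a| ≤ Real.pi) :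
    4 / Real.pi ^ 2 * a ^ 2 ≤ 2 * (1 - Real.cos a) := by
  have hπ := Real.pi_pos
  -- reduce to `b = |a|`
  have hcos : Real.cos a = Real.cos |a| := by
    rcases abs_choice a with h | h <;> rw [h]; rw [Real.cos_neg]
  have hsq : a ^ 2 = |a| ^ 2 := (sq_abs a).symm
  rw [hcos, hsq]
  set b := |a| with hb
  have hb0 : 0 ≤ b := abs_nonneg a
  have hkey : 1 - Real.cos b = 2 * Real.sin (b / 2) ^ 2 := by
    rw [Real.sin_sq_eq_half_sub, show 2 * (b / 2) = b by ring]; ring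
  have hj : 2 / Real.pi * (b / 2) ≤ Real.sin (b / 2) :=
    Real.mul_le_sin (by positivity) (by linarith)
  have hj0 : 0 ≤ 2 / Real.pi * (b / 2) := by positivity
  have hj2 := pow_le_pow_left₀ hj0 hj 2
  rw [hkey]
  have e : 4 / Real.pi ^ 2 * b ^ 2 = 4 * (2 / Real.pi * (b / 2)) ^ 2 := by
    field_simp
  rw [e]
  linarith

/-- The zone lower bound: `(4/π²) |p|² ≤ h(p)` on the Brillouin zone. -/
theorem sq_le_hsymb {p : Fin 4 → ℝ} (hp : ∀ μ, |p μ| ≤ Real.pi) :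
    4 / Real.pi ^ 2 * ∑ μ, p μ ^ 2 ≤ hsymb p := by
  have h1 : ∀ μ, 4 / Real.pi ^ 2 * p μ ^ 2 ≤ Real.sin (p μ) ^ 2 + (1 - Real.cos (p μ)) ^ 2 := by
    intro μ
    have h := sq_le_one_sub_cos (hp μ)
    nlinarith [Real.sin_sq_add_cos_sq (p μ)]
  have h2 : ∑ μ, (1 - Real.cos (p μ)) ^ 2 ≤ (∑ μ, (1 - Real.cos (p μ))) ^ 2 := by
    have h0 : ∀ μ ∈ (Finset.univ : Finset (Fin 4)), 0 ≤ 1 - Real.cos (p μ) :=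
      fun μ _ => by linarith [Real.cos_le_one (p μ)]
    exact Finset.sum_sq_le_sq_sum_of_nonneg h0
  unfold hsymb
  rw [Finset.mul_sum]
  calc ∑ μ, 4 / Real.pi ^ 2 * p μ ^ 2
      ≤ ∑ μ, (Real.sin (p μ) ^ 2 + (1 - Real.cos (p μ)) ^ 2) := Finset.sum_le_sum fun μ _ => h1 μ
    _ = (∑ μ, Real.sin (p μ) ^ 2) + ∑ μ, (1 - Real.cos (p μ)) ^ 2 := Finset.sum_add_distrib
    _ ≤ _ := by linarith

/-- The Gaussian product majorant of the shifted symbol factor on the zone: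
`e^{−t h(p)/2} ≤ Π_μ e^{−(2t/π²) p_μ²}` for `t ≥ 0`, `|p_μ| ≤ π`. -/
theorem exp_neg_half_hsymb_le_prod {t : ℝ} (ht : 0 ≤ t) {p : Fin 4 → ℝ}
    (hp : ∀ μ, |p μ| ≤ Real.pi) :
    Real.exp (-(t * (hsymb p / 2))) ≤ ∏ μ, Real.exp (-(2 * t / Real.pi ^ 2 * p μ ^ 2)) := by
  rw [← Real.exp_sum, Real.exp_le_exp]
  have h := sq_le_hsymb hp
  have e : ∑ μ, -(2 * t / Real.pi ^ 2 * p μ ^ 2) = -(t * ((4 / Real.pi ^ 2 * ∑ μ, p μ ^ 2) / 2)) := by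
    rw [Finset.mul_sum, Finset.sum_div, Finset.mul_sum, ← Finset.sum_neg_distrib]
    exact Finset.sum_congr rfl fun μ _ => by ring
  rw [e]
  nlinarith [mul_le_mul_of_nonneg_left h ht]

/-- Registered headline of this helper file (aux stub of `stub_freeMajorantToolkit`): the key
pointwise estimate `Re H(p + iη) ≥ h(p)/2 − 14|η|²` of the contour shift. -/
theorem stub_freeMajorantToolkitAuxD : ∀ (p η : Fin 4 → ℝ) (ξ : Fin 4 → ℂ), (∀ μ, ξ μ = (p μ : ℂ) + (η μ : ℂ) * Complex.I) → (∀ μ, |η μ| ≤ 1) → hsymb p / 2 - 14 * ∑ μ, η μ ^ 2 ≤ ((∑ μ, Complex.sin (ξ μ) ^ 2) + (∑ μ, (1 - Complex.cos (ξ μ))) ^ 2).re :=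
  fun p η ξ hξ hη => re_symbol_shift_ge p η ξ hξ hη

end Summit.QuantumFields.QCD.Cruxes.QuarkLoopCoefficient.Sketch.FreeMajorantToolkit
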